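import Summits.ResolutionOfSingularities.ResolutionOfSingularities.Theorems.PurelyInseparableDim4ResConeWeightLedgerPermanence
import HarnessLib
import HarnessLib.Audit.Tags

/-!
# Purely inseparable four-folds — T-SECTOR LOSSY TAILS OF SHADE `3`, EVERY PRIME `p ≥ 11`: one permanent letter of weight `p − 4`,
# two active letters of weights `(2, ≤ 1)`
# (cell `res-dim4-pi`, K2(p) lane, B-LOSSY row «`(p, 3)`: frozen `p − 4` + active `(2)/(2,1)`», the `p`-generic form of the `(7, 3)` row;
# seat res-dim4-p-8 g7)

[OURS · counted 0 · cell `res-dim4-pi` · K2(p) lane (holder res-dim4-p-12 g5, B-LOSSY row list bus 2026-08-29 l.6609: «(7,3), t = 4: ONE type only,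
{(3,2),(3,2,1)} with a FROZEN never-hit weight-3 letter») · seat res-dim4-p-8 g7.]  **HONEST LABEL.**  A p-GENERIC LEDGER THEOREM about OUR
frame (weights only, no certificate, no `decide`): it confines a hypothetical lossy shade-`3` tail with a weightless uncharted letter to ONE
weight pattern; it kills nothing.  Nothing here proves any TAIL(p, 3, ·), K2(7), K2(p), `NoIsolatedTrap p p`, CJS 6.40 or resolution of
singularities in dimension ≥ 4 / characteristic `p` — NOT proved.  AI kernel work, weaker than expert review.

THE THEOREM **`tsector_lossy_shade_three`** (every prime `p ≥ 11`; the case `p = 7` is the kernel certificate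
`tail_tsector_lossy_seven_3` of `…WeightLedgerSevenTSectorLossy`, same shape `(3; 2, ≤ 1; 0)`): along a witnessed isolated above-floor
`Step0 p` chain with `x^{r₀} ∣ F₀`, constant shade `3` from `k₀`, LOSSY beyond every index, and a letter `φ` weightless and uncharted from
`k₀` (res-dim4-p-1's T-sector normal form p715478 for the form-carrying letter; any `e_G`), there are a letter `z ≠ φ` and a time `k₂` with,
for every `k ≥ k₂`: `r_k z = p − 4`, `z` is neither charted nor translated, and the two remaining letters weigh `2` and `≤ 1`.
PROOF (ledger only). LEGAL gives `p − 2 ≤ |r| ≤ p − 1` (floor; triple law on the three letters `≠ φ`), so every chart hands out weight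
`1` or `2` and a charted letter weighs `≤ 2` for ever after (`small_persist`).  FT (`exists_satellite_after`) gives two distinct charted
letters `x, y`; the fourth letter `z` then weighs `≥ p − 6 ≥ 5`, hence is never charted and never lost: PERMANENT of constant weight `m`.
res-dim4-p-5's `no_tail_of_permanent_weight_ge` forces `m ≤ p − 4`; a lossy step at weight `m` needs `m + (|r| + 3 − p) ≥ p − 2`, i.e.
`m ≥ p − 4` — so `m = p − 4`; finally the active pattern `(1, 1)` is loss-free and absorbing, so the active weights are `(2, 0)` or `(2, 1)`
(in some order) at every late time.
[cite: CossartJannsenSaito2020, Thm. 3.14] [cite: HauserPerlega2019PRIMS, §2] bears_on: LADDER-RESOLUTION:D157-DOOR2 (res-dim4-pi · K2(p) B-LOSSY ·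
T-sector lossy `(p, 3)` row ∀ p).  Supports stmt-ResolutionOfSingularities-16155 (helper).
-/

set_option linter.dupNamespace false -- mandated namespace of this single-conjunct summit

noncomputable section

namespace Summit.ResolutionOfSingularities.ResolutionOfSingularities.Theorems.PIDim4

namespace ResCone

open MvPolynomial Finset Literature.AlgebraicGeometry.Resolution
open Literature.AlgebraicGeometry.Resolution.CentreBlowup Literature.AlgebraicGeometry.Resolution.Hauser2010
open WeightLedger

namespace WeightLedger

/-- The fourth letter: given three distinct letters of `Fin 4`, the remaining one; the four exhaust `Fin 4`. [folklore] -/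
theorem exists_fourth_letter {x y φ : Fin 4} (hxy : x ≠ y) (hxφ : x ≠ φ) (hyφ : y ≠ φ) :
    ∃ z : Fin 4, z ≠ x ∧ z ≠ y ∧ z ≠ φ ∧ ∀ i : Fin 4, i = x ∨ i = y ∨ i = z ∨ i = φ := by
  revert x y φ
  decide

/-- The three letters other than a given one. [folklore] -/
theorem exists_three_others (φ : Fin 4) :
    ∃ u v w : Fin 4, u ≠ v ∧ u ≠ w ∧ v ≠ w ∧ u ≠ φ ∧ v ≠ φ ∧ w ≠ φ := by
  revert φ
  decide

/-- `wsum` along four distinct letters. [folklore] -/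
theorem wsum_eq_four (a : Fin 4 → ℕ) {x y z φ : Fin 4} (hxy : x ≠ y) (hxz : x ≠ z) (hxφ : x ≠ φ) (hyz : y ≠ z)
    (hyφ : y ≠ φ) (hzφ : z ≠ φ) : wsum a = a x + a y + a z + a φ := by
  classical
  have hx : x ∉ ({y, z, φ} : Finset (Fin 4)) := by simp [hxy, hxz, hxφ]
  have hy : y ∉ ({z, φ} : Finset (Fin 4)) := by simp [hyz, hyφ]
  have huniv : ({x, y, z, φ} : Finset (Fin 4)) = Finset.univ := by
    apply Finset.eq_univ_of_card
    rw [Finset.card_insert_of_notMem hx, Finset.card_insert_of_notMem hy, Finset.card_pair hzφ]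
    rfl
  have h1 : ∑ i, a i = a x + a y + a z + a φ := by
    rw [← huniv, Finset.sum_insert hx, Finset.sum_insert hy, Finset.sum_pair hzφ]
    ring
  rw [← h1, Fin.sum_univ_four]

end WeightLedger

section Chain

variable {K : Type} [Field K] (p : ℕ) [Fact p.Prime] [CharP K p] [DecidableEq K]
  {c : ℕ → State K} {j : ℕ → Fin 4} {b : ℕ → Fin 4 → K}

/-- **T-SECTOR LOSSY TAILS OF SHADE `3`** (every prime `p ≥ 11`, any `e_G`): one permanent letter of weight exactly `p − 4`, never charted nor
translated, and the two other non-carrier letters weigh `2` and `≤ 1` at every late time. [OURS] [cite: CossartJannsenSaito2020, Thm. 3.14] -/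
theorem tsector_lossy_shade_three (hp : 11 ≤ p)
    (hc : ∀ k, IsIsolated p (c k).F ∧ Step0 p (c k) (c (k + 1))) (hw : FreeTail.IsWitnessedChain p c j b)
    (hr0 : ∀ e ∈ (c 0).F.support, (c 0).r ≤ e) (hfloor : ∀ k, ordZero (c k).F ≠ p) {k₀ : ℕ}
    (hshade : ∀ k, k₀ ≤ k → (c k).shade = ((3 : ℕ) : ℕ∞)) (hlossy : ∀ k₂, ∃ k, k₂ ≤ k ∧ Lossy ⇑(c k).r ⇑(c (k + 1)).r)
    {φ : Fin 4} (hφ : ∀ k, k₀ ≤ k → (c k).r φ = 0 ∧ j k ≠ φ) :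
    ∃ (z : Fin 4) (k₂ : ℕ), k₀ ≤ k₂ ∧ z ≠ φ ∧
      (∀ k, k₂ ≤ k → (c k).r z = p - 4 ∧ j k ≠ z ∧ b k z = 0) ∧
      (∀ k, k₂ ≤ k → ∃ x y : Fin 4, x ≠ y ∧ x ≠ z ∧ x ≠ φ ∧ y ≠ z ∧ y ≠ φ ∧ (c k).r x = 2 ∧ (c k).r y ≤ 1) := by
  classical
  have hleg : ∀ k, k₀ ≤ k → Legal p 3 ⇑(c k).r := fun k hk => tail_ledger_legal p hc hw hr0 hfloor hshade hk
  have hchild : ∀ k, k₀ ≤ k → ⇑(c (k + 1)).r = child p 3 ⇑(c k).r (j k) (fun i => decide (b k i = 0)) :=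
    fun k hk => tail_ledger_child p hc hw hr0 hfloor hshade hk
  -- one-step readings of the child law
  have hnew : ∀ k, k₀ ≤ k → (c (k + 1)).r (j k) = wsum ⇑(c k).r + 3 - p := fun k hk => by
    have h1 := congrFun (hchild k hk) (j k); rwa [child_apply_self] at h1
  have hoff : ∀ k, k₀ ≤ k → ∀ i, i ≠ j k → (c (k + 1)).r i = (if b k i = 0 then (c k).r i else 0) :=
    fun k hk i hi => by have h1 := congrFun (hchild k hk) i; rwa [child_apply_of_ne_decide _ hi] at h1
  have hoff_le : ∀ k, k₀ ≤ k → ∀ i, i ≠ j k → (c (k + 1)).r i ≤ (c k).r i := fun k hk i hi => by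
    rw [hoff k hk i hi]; split_ifs <;> omega
  -- the band: `p − 2 ≤ |r| ≤ p − 1` (floor; triple law on the three letters other than `φ`)
  obtain ⟨u, v, w, huv, huw, hvw, huφ, hvφ, hwφ⟩ := WeightLedger.exists_three_others φ
  have hband : ∀ k, k₀ ≤ k → p ≤ wsum ⇑(c k).r + 2 ∧ wsum ⇑(c k).r + 1 ≤ p := by
    intro k hk
    obtain ⟨hfl, -, -, htri⟩ := hleg k hk
    have h3 := htri u v w huv huw hvw
    have hs := WeightLedger.wsum_eq_four ⇑(c k).r huv huw huφ hvw hvφ hwφ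
    have hφ0 : (⇑(c k).r) φ = 0 := (hφ k hk).1
    constructor <;> omega
  -- newborn weights are `1` or `2`; a charted letter stays `≤ 2`
  have hnew_le : ∀ k, k₀ ≤ k → 1 ≤ (c (k + 1)).r (j k) ∧ (c (k + 1)).r (j k) ≤ 2 := fun k hk => by
    have h1 := hnew k hk; have h2 := hband k hk; omega
  have persist : ∀ k, k₀ ≤ k → ∀ i, (c k).r i ≤ 2 → ∀ n, (c (k + n)).r i ≤ 2 := by
    intro k hk i hi n
    induction n with
    | zero => simpa using hi
    | succ n ih =>
      rw [← Nat.add_assoc]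
      by_cases hij : i = j (k + n)
      · rw [hij]; exact (hnew_le (k + n) (by omega)).2
      · exact le_trans (hoff_le (k + n) (by omega) i hij) ih
  -- FT: two distinct charted letters `x`, `y`
  obtain ⟨k₁, hk₁, hsat⟩ := exists_satellite_after p hc hw k₀
  set x := j k₁ with hx
  set y := j (k₁ + 1) with hy
  have hxy : x ≠ y := fun h => hsat.1 (by rw [← hx, ← hy, h])
  have hxφ : x ≠ φ := (hφ k₁ hk₁).2
  have hyφ : y ≠ φ := (hφ (k₁ + 1) (by omega)).2
  set K := k₁ + 2 with hK
  have hxK : ∀ k, K ≤ k → (c k).r x ≤ 2 := fun k hk => by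
    obtain ⟨n, rfl⟩ := Nat.exists_eq_add_of_le (show k₁ + 1 ≤ k by omega)
    exact persist (k₁ + 1) (by omega) x (hnew_le k₁ hk₁).2 n
  have hyK : ∀ k, K ≤ k → (c k).r y ≤ 2 := fun k hk => by
    obtain ⟨n, rfl⟩ := Nat.exists_eq_add_of_le hk
    have h0 : (c (k₁ + 1 + 1)).r y ≤ 2 := (hnew_le (k₁ + 1) (by omega)).2
    exact persist (k₁ + 2) (by omega) y (by simpa [hK] using h0) n
  -- the fourth letter `z`: heavy, hence never charted, never lost, of constant weight `m`
  obtain ⟨z, hzx, hzy, hzφ, hexh⟩ := WeightLedger.exists_fourth_letter hxy hxφ hyφ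
  have hsum4 : ∀ a : Fin 4 → ℕ, wsum a = a x + a y + a z + a φ :=
    fun a => WeightLedger.wsum_eq_four a hxy hzx.symm hxφ hzy.symm hyφ hzφ
  have hzK : ∀ k, K ≤ k → p ≤ (c k).r z + 6 := fun k hk => by
    have h1 := hband k (by omega); have h2 := hsum4 ⇑(c k).r; have h3 := hxK k hk; have h4 := hyK k hk
    have hφ0 : (⇑(c k).r) φ = 0 := (hφ k (by omega)).1
    omega
  have hjz : ∀ k, K ≤ k → j k ≠ z := fun k hk hjk => by
    have h1 := (hnew_le k (by omega)).2; rw [hjk] at h1; have h2 := hzK (k + 1) (by omega); omega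
  have hbz : ∀ k, K ≤ k → b k z = 0 := fun k hk => by
    by_contra hne
    have h1 := hoff k (by omega) z (Ne.symm (hjz k hk)); rw [if_neg hne] at h1
    have h2 := hzK (k + 1) (by omega); omega
  have hzconst : ∀ k, K ≤ k → (c k).r z = (c K).r z := by
    intro k hk
    obtain ⟨n, rfl⟩ := Nat.exists_eq_add_of_le hk
    induction n with
    | zero => rfl
    | succ n ih =>
      rw [← ih (by omega), ← Nat.add_assoc]
      have h1 := hoff (K + n) (by omega) z (Ne.symm (hjz (K + n) (by omega)))
      rwa [if_pos (hbz (K + n) (by omega))] at h1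
  set m := (c K).r z with hm
  -- `m ≤ p − 4` by res-dim4-p-5's heavy permanent set
  have hm4 : m + 4 ≤ p := by
    by_contra hlt
    refine no_tail_of_permanent_weight_ge p hc hw hr0 hfloor hshade (M := K) (by omega) (P := {z}) ?_ ?_
    · intro z' hz' m' hm'
      rw [Finset.mem_singleton] at hz'; subst hz'
      exact ⟨Ne.symm (hjz m' hm'), hbz m' hm'⟩
    · rw [Finset.sum_singleton]; omega
  -- every late lossy step loses an active letter and needs `m ≥ p − 4`
  have hloss : ∀ k, K ≤ k → Lossy ⇑(c k).r ⇑(c (k + 1)).r →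
      wsum ⇑(c (k + 1)).r = wsum ⇑(c k).r + 3 - p + m := by
    intro k hk ⟨i, hi1, hi0⟩
    have hkk : k₀ ≤ k := by omega
    have hφ0 : (⇑(c k).r) φ = 0 := (hφ k hkk).1
    have hφ0' : (⇑(c (k + 1)).r) φ = 0 := (hφ (k + 1) (by omega)).1
    have hzk1 : (c (k + 1)).r z = m := hzconst (k + 1) (by omega)
    have hzk : (c k).r z = m := hzconst k hk
    have hij : i ≠ j k := fun h => by have := (hnew_le k hkk).1; rw [← h] at this; omega
    have hiz : i ≠ z := fun h => by rw [h] at hi0; have := hzK (k + 1) (by omega); omega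
    have hiφ : i ≠ φ := fun h => by rw [h] at hi1; omega
    have hs0 := hsum4 ⇑(c k).r
    have hs1 := hsum4 ⇑(c (k + 1)).r
    have hnk := hnew k hkk
    -- the chart is `x` or `y`, and `i` is the other one
    rcases hexh (j k) with hj | hj | hj | hj
    · rcases hexh i with rfl | rfl | rfl | rfl
      · exact absurd hj.symm hij
      · rw [hj] at hnk; omega
      · exact absurd rfl hiz
      · exact absurd rfl hiφ
    · rcases hexh i with rfl | rfl | rfl | rfl
      · rw [hj] at hnk; omega
      · exact absurd hj.symm hij
      · exact absurd rfl hiz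
      · exact absurd rfl hiφ
    · exact absurd hj (hjz k hk)
    · exact absurd hj (hφ k hkk).2
  have hm_eq : m + 4 = p := by
    obtain ⟨k, hk, hl⟩ := hlossy K
    have h1 := hloss k hk hl
    have h2 := hband k (by omega); have h3 := hband (k + 1) (by omega)
    omega
  -- the active pattern `(1, 1)` is loss-free and absorbing: it never occurs
  have hno11 : ∀ k, K ≤ k → ¬ ((c k).r x = 1 ∧ (c k).r y = 1) := by
    intro k hk h11
    -- it persists
    have stay : ∀ n, (c (k + n)).r x = 1 ∧ (c (k + n)).r y = 1 := by
      intro n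
      induction n with
      | zero => simpa using h11
      | succ n ih =>
        rw [← Nat.add_assoc]
        have hkn : k₀ ≤ k + n := by omega
        have hb0 := hband (k + n) hkn
        have hb1 := hband (k + n + 1) (by omega)
        have hs0 := hsum4 ⇑(c (k + n)).r
        have hs1 := hsum4 ⇑(c (k + n + 1)).r
        have hφ0 : (⇑(c (k + n)).r) φ = 0 := (hφ (k + n) hkn).1
        have hφ1 : (⇑(c (k + n + 1)).r) φ = 0 := (hφ (k + n + 1) (by omega)).1
        have hz0 : (c (k + n)).r z = m := hzconst (k + n) (by omega)
        have hz1 : (c (k + n + 1)).r z = m := hzconst (k + n + 1) (by omega)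
        have hnk := hnew (k + n) hkn
        rcases hexh (j (k + n)) with hj | hj | hj | hj
        · -- chart x: x ← 1, y kept (else the total drops below the floor)
          have hyv := hoff_le (k + n) hkn y (by rw [hj]; exact hxy.symm)
          rw [hj] at hnk
          omega
        · have hxv := hoff_le (k + n) hkn x (by rw [hj]; exact hxy)
          rw [hj] at hnk
          omega
        · exact absurd hj (hjz (k + n) (by omega))
        · exact absurd hj (hφ (k + n) hkn).2
    -- but a lossy step comes
    obtain ⟨k', hk', hl⟩ := hlossy k
    obtain ⟨n, rfl⟩ := Nat.exists_eq_add_of_le hk'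
    have h1 := hloss (k + n) (by omega) hl
    have hb0 := hband (k + n) (by omega); have hb1 := hband (k + n + 1) (by omega)
    have hs0 := hsum4 ⇑(c (k + n)).r; have hs1 := hsum4 ⇑(c (k + n + 1)).r
    have hφ0 : (⇑(c (k + n)).r) φ = 0 := (hφ (k + n) (by omega)).1
    have hφ1 : (⇑(c (k + n + 1)).r) φ = 0 := (hφ (k + n + 1) (by omega)).1
    have hz0 : (c (k + n)).r z = m := hzconst (k + n) (by omega)
    have hz1 : (c (k + n + 1)).r z = m := hzconst (k + n + 1) (by omega)
    have e0 := stay n; have e1 := stay (n + 1)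
    rw [show k + (n + 1) = k + n + 1 by ring] at e1
    omega
  -- conclusion
  refine ⟨z, K, by omega, hzφ, fun k hk => ⟨by rw [hzconst k hk]; omega, hjz k hk, hbz k hk⟩, fun k hk => ?_⟩
  have hb := hband k (by omega)
  have hs := hsum4 ⇑(c k).r
  have hφ0 : (⇑(c k).r) φ = 0 := (hφ k (by omega)).1
  have hzk : (c k).r z = m := hzconst k hk
  have h3 := hxK k hk; have h4 := hyK k hk; have h5 := hno11 k hk
  by_cases hx2 : (c k).r x = 2
  · exact ⟨x, y, hxy, hzx.symm, hxφ, hzy.symm, hyφ, hx2, by omega⟩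
  · exact ⟨y, x, hxy.symm, hzy.symm, hyφ, hzx.symm, hxφ, by omega, by omega⟩

end Chain

end ResCone

end Summit.ResolutionOfSingularities.ResolutionOfSingularities.Theorems.PIDim4

end
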